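import Mathlib.Data.ZMod.Basic
import Mathlib.Algebra.IsPrimePow
import Mathlib.Analysis.SpecialFunctions.Pow.Real
import Mathlib.Analysis.SpecialFunctions.Log.Basic
import Literature.Computability.AlgebraicComplexity.GroupTheoreticMatMul
import Literature.Barriers.MatrixMultiplication.TricoloredSumFreeBarrierProofs
import HarnessLib

/-!
# Tight arithmetic triangle removal in `𝔽_pⁿ` (Fox–Lovász 2017) and the packing barrier for
# STPP constructions in `(ℤ/q)^ℓ` (Pratt 2024, Cor. 2.10 — refuted as printed, see below)

Topic `Literature/Combinatorics/Additive` (family `MatrixMultiplication`). Requested by route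
`MatrixMultiplication/EisensteinValCertificates` (support item `PrimePowerPackingBarrier`, glue
`ValTransfer`) as CITE FACTS: two published results, vendored as named facts with the constants of
the sources, plus proved API on the Fox–Lovász exponents.

## The printed statements

**Fox–Lovász** (J. Fox, L. M. Lovász, *A tight bound for Green's arithmetic triangle removal lemma
in vector spaces*, SODA 2017 / Adv. Math. 321 (2017); held text `paper:arxiv-1606.01230`, p. 3):
"Let `p` be a fixed prime. A triangle in `𝔽_pⁿ` is a triple `(x, y, z)` of points with
`x + y + z = 0`. We use `N = |𝔽_pⁿ| = pⁿ` throughout. […] constants `c_p` which will be between `0`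
and `1` […], and `C_p = 1 + 1/c_p`. […] **Theorem 1.** Let `0 < ε < 1` and `δ = (ε/3)^{C_p}`. If
`X, Y, Z ⊂ 𝔽_pⁿ` with less than `δN²` triangles in `X × Y × Z`, then we can remove `εN` elements
from `X ∪ Y ∪ Z` so that no triangle remains. Furthermore, this bound is essentially tight […]."
and "The exponent is given by `p^{1−c_p} = inf_{0<x<1} x^{−(p−1)/3}(x⁰ + x¹ + ⋯ + x^{p−1})`."
(the Kleinberg–Sawin–Speyer exponent; their Theorem 2). The proof (pp. 5–7: Thm. 3, Thm. 4,
Lemma 5 by a random `d`-dimensional subspace and the multicolored sum-free bound, Lemma 6 by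
iterated removal of high-degree points, the `𝔽_p^{n+2}` disjointification and the tensor-power
trick) is not formalised here.

**Pratt** (K. Pratt, *On generalized corners and matrix multiplication*, ITCS 2024; held text
`paper:arxiv-2309.03878`, p. 6): "**Corollary 2.9.** If `Xᵢ, Yᵢ, Zᵢ` satisfy the STPP in a group `G`
of order `n`, then at least one of `Σ|Xᵢ||Yᵢ|, Σ|Xᵢ||Zᵢ|, Σ|Yᵢ||Zᵢ|` is at most `o(n)`."
"**Corollary 2.10.** There exists an absolute constant `C > 1` such that if `Xᵢ, Yᵢ, Zᵢ` satisfy the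
STPP in `ℤ_q^ℓ`, then at least one of `Σ|Xᵢ||Yᵢ|, Σ|Xᵢ||Zᵢ|, Σ|Yᵢ||Zᵢ|` is at most `(q/C)^ℓ`."
(`q` a prime power, as in Thm. 4.4 where it is used.) Printed proof: the sets
`A₁ = ⊔ᵢ Xᵢ − Yᵢ, A₂ = ⊔ᵢ Yᵢ − Zᵢ, A₃ = ⊔ᵢ Zᵢ − Xᵢ` have at most `q^{3ℓ/2}` solutions of
`a₁ + a₂ + a₃ = 0` (packing bounds and Cauchy–Schwarz) while any subsets of density `0.9999` of
`A₁, A₂, A₃` contain a solution (proof of Cor. 2.9); by Fox–Lovász (footnote: "While [Fox–Lovász]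
is only stated for `ℤ_p^ℓ`, it extends to `ℤ_q^ℓ` by the same argument via the use of [BCCGNSU
2017]" — i.e. with the tricolored sum-free bound of Thm. A′ there, PROVED in the tree as
`Literature.Barriers.MatrixMultiplication.BCCGNSU2017_thmA'_holds`) with `δ = q^{−ℓ/2}` one gets
`ε = 3 q^{Θ(−ℓ/log q)} ≤ 3 C'^{−ℓ}`, "Hence it must have been the case that one of `A₁, A₂, A₃` had
size at most `(q/C)^ℓ` to begin with, for some universal `C`."

## Lean rendering

* `foxLovaszExponent p = c_p` is defined through the tree's rate function `J` of BCCGNSU 2017,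
  eq. (4.10) (`Literature.Barriers.MatrixMultiplication.bccgnsuJ`,
  `J(s) = (1/s) inf_{0<x<1} (Σ_{i<s} xⁱ) x^{−(s−1)/3}`): the printed defining identity
  `p^{1−c_p} = inf_{0<x<1} x^{−(p−1)/3}(x⁰ + ⋯ + x^{p−1})` reads `p^{1−c_p} = p · J(p)`, i.e.
  `c_p = −log J(p) / log p`; the printed identity is RECOVERED as the theorem
  `rpow_one_sub_foxLovaszExponent`. `foxLovaszRemovalExponent p = C_p = 1 + 1/c_p`. PROVED:
  `J(p) > 0` (`bccgnsuJ_pos`), `c_p ≥ δ/log p > 0` for `p ≥ 2` with `δ = log((2/3)2^{2/3})` the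
  constant of BCCGNSU Thm. A′ (`bccgnsuDelta_div_log_le_foxLovaszExponent`, `foxLovaszExponent_pos`,
  from the tree's `bccgnsuJ_le_exp_neg_delta`) — the lower half of the printed
  "`c_p = Θ((log p)^{−1})`" — and `C_p > 1`.
* `FoxLovasz2017_thm1` — **Thm. 1 as printed** (prime `p`, any `n`, `0 < ε < 1`): `X, Y, Z` are
  `Finset`s of `Fin n → ZMod p`, the number of triangles is the cardinality of the filter of
  `X ×ˢ Y ×ˢ Z` by `x + y + z = 0` (the convention of the route file), "remove `εN` elements from
  `X ∪ Y ∪ Z` so that no triangle remains" is `∃ R, |R| ≤ εN ∧ (X∖R) × (Y∖R) × (Z∖R)` has no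
  triangle. The prime-power extension asserted in Pratt's footnote is NOT printed by Fox–Lovász and
  is not vendored.
* `Pratt2024_cor210` — **Cor. 2.10 in the explicit-constants reading of the route** (verbatim the
  route's `PrimePowerPackingBarrier`): `∃ γ > 1, ∃ K, ∀` prime powers `q`, `∀ ℓ`, every STPP family
  `(Aᵢ, Bᵢ, Cᵢ)_{i<N}` in `(ℤ/q)^ℓ` (the tree's `IsSTPP`) has one of `Σ|Aᵢ||Bᵢ|, Σ|Bᵢ||Cᵢ|, Σ|Cᵢ||Aᵢ|`
  at most `K (q/γ)^ℓ`. Print has `K = 1` ("at most `(q/C)^ℓ`"); the printed argument controls the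
  small set only up to absolute factors (the densities `0.9999`, the factor `3` in `ε`, the factor
  `3` of Thm. A′), which `K` absorbs, and the `K = 1` form implies the vendored one
  (`Pratt2024_cor210.of_pow_le`, proved). So the fact is implied by, never stronger than, print.
  **REFUTED** (`not_Pratt2024_cor210`, `TightTriangleRemovalProofs.lean`): the printed corollary
  — and with it this fact and the route item — is FALSE for non-uniform STPP families (a
  three-block family in `𝔽₂³ × 𝔽₂³ × 𝔽₂ⁿ`, one coset of `𝔽₂ⁿ` and two singletons per block, has all
  three packing sums `≥ 2ⁿ = |G|/64`); the gap in print is the pigeonhole step of the proof of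
  Cor. 2.9, which mixes three differently weighted fractions of the block index. What the printed
  argument does prove is the SUM-OF-MINIMA form `Σᵢ min(|Aᵢ||Bᵢ|, |Bᵢ||Cᵢ|, |Cᵢ||Aᵢ|) ≤ K (q/γ)^ℓ`,
  formalised for primes `q = p` conditionally on `FoxLovasz2017_thm1` in
  `TightTriangleRemovalSumMin.lean` (`sum_min_packing_le_of_foxLovasz`); for uniform families it
  gives back the printed disjunction (`packing_disj_of_sum_min_le`, `TightTriangleRemovalProofs.lean`).

## What is NOT claimed

Neither fact is proved here: Fox–Lovász's proof is the business of a `provefact` seat (size L);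
`Pratt2024_cor210` is REFUTED in `TightTriangleRemovalProofs.lean` and its corrected sum-of-minima
form is proved for primes, conditionally on `FoxLovasz2017_thm1`, in
`TightTriangleRemovalSumMin.lean`. No statement about general moduli (Pratt, Remark after Thm. 4.4:
open for `ℤ_n^ℓ`, `n` not a prime power).

## References

* [FoxLovasz2017] J. Fox, L. M. Lovász, *A tight bound for Green's arithmetic triangle removal
  lemma in vector spaces*, Proc. SODA 2017, 1612–1617; Adv. Math. 321 (2017), 287–297;
  arXiv:1606.01230 — §1 Thm. 1, Thm. 2 (p. 3), §2 Thm. 3, Thm. 4, Lemmas 5–6 (pp. 5–7).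
* [Pratt2024] K. Pratt, *On generalized corners and matrix multiplication*, ITCS 2024, LIPIcs 287,
  89:1–17; arXiv:2309.03878 — §2.1 Thm. 2.8, Cor. 2.9, Cor. 2.10 (p. 6), Thm. 4.4 (p. 9).
* [BlasiakChurchCohnGrochowNaslundSawinUmans2017] J. Blasiak et al., *On cap sets and the
  group-theoretic approach to matrix multiplication*, Discrete Analysis 2017:3 — Thm. A′, (4.10).
-/

noncomputable section

open Finset
open scoped BigOperators

namespace Literature.Combinatorics.Additive

open Literature.Barriers.MatrixMultiplication (bccgnsuJ bccgnsuDelta bccgnsuJ_le bccgnsuJ_nonneg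
  bccgnsuJ_le_exp_neg_delta bccgnsuDelta_pos)
open Literature.Computability.AlgebraicComplexity (IsSTPP)

/-! ### The exponents `c_p` and `C_p` -/

section Exponents

/-- **The Kleinberg–Sawin–Speyer / Fox–Lovász exponent `c_p`** (Fox–Lovász 2017, §1:
"`p^{1−c_p} = inf_{0<x<1} x^{−(p−1)/3}(x⁰ + x¹ + ⋯ + x^{p−1})`", so that multicolored sum-free sets
in `𝔽_pⁿ` have size `≤ p^{(1−c_p)n}`, their Thm. 2). Since the infimum is `p · J(p)` for the rate
function `J` of BCCGNSU 2017, (4.10) (the tree's `bccgnsuJ`), `c_p = −log J(p) / log p`; the printed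
identity is `rpow_one_sub_foxLovaszExponent`. (Meaningful for `p ≥ 2`; `c₂ = 5/3 − log₂ 3 ≈ 0.0817`.)
[cite: FoxLovasz2017, §1 (Thm. 2)] [cite: BlasiakChurchCohnGrochowNaslundSawinUmans2017, (4.10)] -/
def foxLovaszExponent (p : ℕ) : ℝ :=
  -Real.log (bccgnsuJ p) / Real.log p

/-- **The removal exponent `C_p = 1 + 1/c_p`** of Fox–Lovász 2017, Thm. 1 (`C₂ ≈ 13.239`,
`C₃ ≈ 13.901`, `C_p = Θ(log p)`). [cite: FoxLovasz2017, §1] -/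
def foxLovaszRemovalExponent (p : ℕ) : ℝ :=
  1 + 1 / foxLovaszExponent p

/-- Each value `(Σ_{i<s} xⁱ) x^{−(s−1)/3}`, `0 < x < 1`, `s ≥ 1`, of the function whose infimum defines
`J(s)` is at least `1` (the sum is `≥ 1`, the power `≥ 1`). [folklore] -/
theorem one_le_geomSum_mul_rpow {s : ℕ} (hs : 1 ≤ s) {x : ℝ} (hx0 : 0 < x) (hx1 : x < 1) :
    1 ≤ (∑ i ∈ Finset.range s, x ^ i) * x ^ (-(((s : ℝ) - 1) / 3)) := by
  have h1 : 1 ≤ ∑ i ∈ Finset.range s, x ^ i := by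
    calc (1 : ℝ) = ∑ i ∈ Finset.range 1, x ^ i := by simp
      _ ≤ ∑ i ∈ Finset.range s, x ^ i :=
        Finset.sum_le_sum_of_subset_of_nonneg (Finset.range_mono hs) fun i _ _ => pow_nonneg hx0.le i
  have hs' : (1 : ℝ) ≤ s := by exact_mod_cast hs
  have h2 : 1 ≤ x ^ (-(((s : ℝ) - 1) / 3)) :=
    Real.one_le_rpow_of_pos_of_le_one_of_nonpos hx0 hx1.le (by linarith)
  nlinarith

/-- The infimum defining `J(s)` is at least `1` (`s ≥ 1`). [folklore] -/
theorem one_le_sInf_geomSum_mul_rpow {s : ℕ} (hs : 1 ≤ s) :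
    1 ≤ sInf ((fun x : ℝ => (∑ i ∈ Finset.range s, x ^ i) * x ^ (-(((s : ℝ) - 1) / 3))) ''
      Set.Ioo (0 : ℝ) 1) := by
  refine le_csInf ⟨_, ⟨1 / 2, ⟨by norm_num, by norm_num⟩, rfl⟩⟩ ?_
  rintro _ ⟨x, ⟨hx0, hx1⟩, rfl⟩
  exact one_le_geomSum_mul_rpow hs hx0 hx1

/-- `J(s) ≥ 1/s` for `s ≥ 1`; in particular `J(s) > 0` (BCCGNSU 2017, (4.10)–(4.11):
`J(s) ∈ (0.84, 1)`). [cite: BlasiakChurchCohnGrochowNaslundSawinUmans2017, (4.10)] -/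
theorem one_div_le_bccgnsuJ {s : ℕ} (hs : 1 ≤ s) : 1 / (s : ℝ) ≤ bccgnsuJ s := by
  rw [bccgnsuJ]
  exact div_le_div_of_nonneg_right (one_le_sInf_geomSum_mul_rpow hs) (Nat.cast_nonneg s)

/-- `J(s) > 0` for `s ≥ 1`. [cite: BlasiakChurchCohnGrochowNaslundSawinUmans2017, (4.10)] -/
theorem bccgnsuJ_pos {s : ℕ} (hs : 1 ≤ s) : 0 < bccgnsuJ s := by
  have hs' : (0 : ℝ) < s := by exact_mod_cast hs
  exact lt_of_lt_of_le (one_div_pos.2 hs') (one_div_le_bccgnsuJ hs)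

/-- `p^{−c_p} = J(p)` (`p ≥ 2`). [cite: FoxLovasz2017, §1 (Thm. 2)] -/
theorem rpow_neg_foxLovaszExponent {p : ℕ} (hp : 2 ≤ p) :
    (p : ℝ) ^ (-foxLovaszExponent p) = bccgnsuJ p := by
  have hp0 : (0 : ℝ) < p := by exact_mod_cast (show 0 < p by omega)
  have hp1 : (p : ℝ) ≠ 1 := by exact_mod_cast (show p ≠ 1 by omega)
  have hJ : 0 < bccgnsuJ p := bccgnsuJ_pos (by omega)
  have hlogp : Real.log p ≠ 0 := Real.log_ne_zero_of_pos_of_ne_one hp0 hp1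
  rw [foxLovaszExponent, Real.rpow_def_of_pos hp0, neg_div, neg_neg,
    mul_div_cancel₀ _ hlogp, Real.exp_log hJ]

/-- **The printed definition of `c_p`**: `p^{1−c_p} = inf_{0<x<1} x^{−(p−1)/3}(x⁰ + x¹ + ⋯ + x^{p−1})`
(Fox–Lovász 2017, §1, display before Thm. 2), for `p ≥ 2`. [cite: FoxLovasz2017, §1 (Thm. 2)] -/
theorem rpow_one_sub_foxLovaszExponent {p : ℕ} (hp : 2 ≤ p) :
    (p : ℝ) ^ (1 - foxLovaszExponent p) =
      sInf ((fun x : ℝ => x ^ (-(((p : ℝ) - 1) / 3)) * ∑ i ∈ Finset.range p, x ^ i) ''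
        Set.Ioo (0 : ℝ) 1) := by
  have hp0 : (0 : ℝ) < p := by exact_mod_cast (show 0 < p by omega)
  have hfun : (fun x : ℝ => x ^ (-(((p : ℝ) - 1) / 3)) * ∑ i ∈ Finset.range p, x ^ i) =
      fun x : ℝ => (∑ i ∈ Finset.range p, x ^ i) * x ^ (-(((p : ℝ) - 1) / 3)) :=
    funext fun x => mul_comm _ _
  rw [sub_eq_add_neg, Real.rpow_add hp0, Real.rpow_one, rpow_neg_foxLovaszExponent hp, hfun,
    bccgnsuJ, mul_div_cancel₀ _ hp0.ne']

/-- **`c_p ≥ δ / log p`** for `p ≥ 2`, with `δ = log((2/3)2^{2/3}) = 0.0566…` the constant of BCCGNSU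
2017, Thm. A′ (from the tree's `J(p) ≤ e^{−δ}`, `bccgnsuJ_le_exp_neg_delta`): the lower half of
Fox–Lovász's "`c_p = Θ((log p)^{−1})`". [cite: FoxLovasz2017, §1]
[cite: BlasiakChurchCohnGrochowNaslundSawinUmans2017, Thm. A′ (proof)] -/
theorem bccgnsuDelta_div_log_le_foxLovaszExponent {p : ℕ} (hp : 2 ≤ p) :
    bccgnsuDelta / Real.log p ≤ foxLovaszExponent p := by
  have hp1 : (1 : ℝ) < p := by exact_mod_cast (show 1 < p by omega)
  have hJ0 : 0 < bccgnsuJ p := bccgnsuJ_pos (by omega)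
  have hlogp : 0 < Real.log p := Real.log_pos hp1
  have hlogJ : Real.log (bccgnsuJ p) ≤ -bccgnsuDelta := by
    have h := Real.log_le_log hJ0 (bccgnsuJ_le_exp_neg_delta hp)
    rwa [Real.log_exp] at h
  rw [foxLovaszExponent]
  exact div_le_div_of_nonneg_right (by linarith) hlogp.le

/-- **`c_p > 0`** for `p ≥ 2` (Fox–Lovász: "`c_p` will be between `0` and `1`").
[cite: FoxLovasz2017, §1] -/
theorem foxLovaszExponent_pos {p : ℕ} (hp : 2 ≤ p) : 0 < foxLovaszExponent p := by
  have hp1 : (1 : ℝ) < p := by exact_mod_cast (show 1 < p by omega)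
  exact lt_of_lt_of_le (div_pos bccgnsuDelta_pos (Real.log_pos hp1))
    (bccgnsuDelta_div_log_le_foxLovaszExponent hp)

/-- **`C_p > 1`** for `p ≥ 2` (so `δ = (ε/3)^{C_p} < ε/3` for `0 < ε < 1`). [cite: FoxLovasz2017, §1] -/
theorem one_lt_foxLovaszRemovalExponent {p : ℕ} (hp : 2 ≤ p) : 1 < foxLovaszRemovalExponent p := by
  rw [foxLovaszRemovalExponent, lt_add_iff_pos_right]
  exact one_div_pos.2 (foxLovaszExponent_pos hp)

end Exponents

/-! ### Named fact: Fox–Lovász, Theorem 1 -/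

section Removal

/-- **Tight arithmetic triangle removal in `𝔽_pⁿ`** (Fox–Lovász 2017, Thm. 1: "Let `0 < ε < 1`
and `δ = (ε/3)^{C_p}`. If `X, Y, Z ⊂ 𝔽_pⁿ` with less than `δN²` triangles in `X × Y × Z`, then we
can remove `εN` elements from `X ∪ Y ∪ Z` so that no triangle remains."; `p` prime, `N = pⁿ`, a
triangle is `(x, y, z) ∈ X × Y × Z` with `x + y + z = 0`, `C_p = foxLovaszRemovalExponent p`).
Rendering: the triangle count is `#{t ∈ X ×ˢ Y ×ˢ Z | t.1 + t.2.1 + t.2.2 = 0}`; the removed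
elements form one `Finset R` with `|R| ≤ εN`, deleted from all three sets. (The second sentence of
Thm. 1, optimality `δ ≤ ε^{C_p − o(1)}`, is not vendored; nor is the prime-power extension
asserted in Pratt 2024, footnote to Cor. 2.10.) A named fact: the printed proof (random subspaces,
the multicolored sum-free bound of Kleinberg–Sawin–Speyer / BCCGNSU, iterated high-degree
removal, tensor-power trick) is not formalised here. [cite: FoxLovasz2017, Thm. 1] -/
def FoxLovasz2017_thm1 : Prop :=
  ∀ (p : ℕ), p.Prime → ∀ (n : ℕ) (ε : ℝ), 0 < ε → ε < 1 →
    ∀ X Y Z : Finset (Fin n → ZMod p),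
      ((((X ×ˢ Y ×ˢ Z).filter fun t : (Fin n → ZMod p) × (Fin n → ZMod p) × (Fin n → ZMod p) =>
            t.1 + t.2.1 + t.2.2 = 0).card : ℕ) : ℝ) <
          (ε / 3) ^ foxLovaszRemovalExponent p * ((p : ℝ) ^ n) ^ 2 →
      ∃ R : Finset (Fin n → ZMod p), (R.card : ℝ) ≤ ε * (p : ℝ) ^ n ∧
        ∀ x ∈ X, x ∉ R → ∀ y ∈ Y, y ∉ R → ∀ z ∈ Z, z ∉ R → x + y + z ≠ 0

/-- Unfolding of `FoxLovasz2017_thm1`. [cite: FoxLovasz2017, Thm. 1] -/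
theorem foxLovasz2017_thm1_iff :
    FoxLovasz2017_thm1 ↔
      ∀ (p : ℕ), p.Prime → ∀ (n : ℕ) (ε : ℝ), 0 < ε → ε < 1 →
        ∀ X Y Z : Finset (Fin n → ZMod p),
          ((((X ×ˢ Y ×ˢ Z).filter fun t : (Fin n → ZMod p) × (Fin n → ZMod p) × (Fin n → ZMod p) =>
                t.1 + t.2.1 + t.2.2 = 0).card : ℕ) : ℝ) <
              (ε / 3) ^ foxLovaszRemovalExponent p * ((p : ℝ) ^ n) ^ 2 →
          ∃ R : Finset (Fin n → ZMod p), (R.card : ℝ) ≤ ε * (p : ℝ) ^ n ∧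
            ∀ x ∈ X, x ∉ R → ∀ y ∈ Y, y ∉ R → ∀ z ∈ Z, z ∉ R → x + y + z ≠ 0 :=
  Iff.rfl

/-- The threshold `δN² = (ε/3)^{C_p} p^{2n}` of Thm. 1 is positive (`0 < ε`), so the hypothesis
"less than `δN²` triangles" is satisfiable (e.g. by triangle-free triples). [cite: FoxLovasz2017, Thm. 1] -/
theorem foxLovasz_threshold_pos {p : ℕ} (hp : p.Prime) (n : ℕ) {ε : ℝ} (hε : 0 < ε) :
    0 < (ε / 3) ^ foxLovaszRemovalExponent p * ((p : ℝ) ^ n) ^ 2 := by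
  have hp0 : (0 : ℝ) < p := by exact_mod_cast hp.pos
  exact mul_pos (Real.rpow_pos_of_pos (by positivity) _) (by positivity)

/-- The threshold is below `(ε/3) · N²` for `0 < ε < 1` and `p ≥ 2` (since `C_p > 1` and `ε/3 < 1`):
Thm. 1 only ever concerns triples with fewer than `(ε/3)N²` triangles. [cite: FoxLovasz2017, Thm. 1] -/
theorem foxLovasz_threshold_lt {p : ℕ} (hp : p.Prime) (n : ℕ) {ε : ℝ} (hε0 : 0 < ε) (hε1 : ε < 1) :
    (ε / 3) ^ foxLovaszRemovalExponent p * ((p : ℝ) ^ n) ^ 2 < ε / 3 * ((p : ℝ) ^ n) ^ 2 := by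
  have hp0 : (0 : ℝ) < p := by exact_mod_cast hp.pos
  have hN : (0 : ℝ) < ((p : ℝ) ^ n) ^ 2 := by positivity
  refine mul_lt_mul_of_pos_right ?_ hN
  have h3 : ε / 3 < 1 := by linarith
  calc (ε / 3) ^ foxLovaszRemovalExponent p < (ε / 3) ^ (1 : ℝ) :=
        Real.rpow_lt_rpow_of_exponent_gt (by positivity) h3 (one_lt_foxLovaszRemovalExponent hp.two_le)
    _ = ε / 3 := Real.rpow_one _

end Removal

/-! ### Named fact: Pratt, Corollary 2.10 (packing barrier in `(ℤ/q)^ℓ`) -/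

section Packing

/-- **Packing barrier for STPP constructions in `(ℤ/q)^ℓ`** (Pratt 2024, Cor. 2.10: "There exists an
absolute constant `C > 1` such that if `Xᵢ, Yᵢ, Zᵢ` satisfy the STPP in `ℤ_q^ℓ`, then at least one of
`Σ|Xᵢ||Yᵢ|, Σ|Xᵢ||Zᵢ|, Σ|Yᵢ||Zᵢ|` is at most `(q/C)^ℓ`", `q` a prime power; proof: the density
argument of Cor. 2.9 plus tight arithmetic triangle removal, Fox–Lovász Thm. 1 extended to prime
powers via BCCGNSU Thm. A′), in the EXPLICIT-CONSTANTS reading of route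
`MatrixMultiplication/EisensteinValCertificates` (verbatim its support item
`PrimePowerPackingBarrier`): there are absolute `γ > 1` and `K` such that for every prime power `q`,
every `ℓ` and every STPP family `(Aᵢ, Bᵢ, Cᵢ)_{i<N}` of finite subsets of `(ℤ/q)^ℓ` (the tree's
`IsSTPP`, CKSU Def. 5.1), one of the packing sums `Σᵢ|Aᵢ||Bᵢ|`, `Σᵢ|Bᵢ||Cᵢ|`, `Σᵢ|Cᵢ||Aᵢ|` is at most
`K (q/γ)^ℓ`. Print is the case `K = 1`, which implies this form (`Pratt2024_cor210.of_pow_le`); the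
absolute factor `K` absorbs the unquantified constants of the printed sketch.
**THIS STATEMENT IS FALSE** — refuted by `not_Pratt2024_cor210` (`TightTriangleRemovalProofs.lean`:
a three-block STPP family in `(ℤ/2)^{n+6}` with all three packing sums `≥ 2ⁿ`); the printed
Cor. 2.9 / 2.10 fail for non-uniform families (pigeonhole gap in the proof of Cor. 2.9). It is kept
verbatim because it is the literal text of the route item `PrimePowerPackingBarrier`; never use it as
a hypothesis except to derive a contradiction. The corrected statement bounds the sum of blockwise
minima `Σᵢ min(|Aᵢ||Bᵢ|, |Bᵢ||Cᵢ|, |Cᵢ||Aᵢ|)` (proved for primes from `FoxLovasz2017_thm1`: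
`sum_min_packing_le_of_foxLovasz`, `TightTriangleRemovalSumMin.lean`).
[cite: Pratt2024, Cor. 2.10] [cite: FoxLovasz2017, Thm. 1] -/
def Pratt2024_cor210 : Prop :=
  ∃ γ : ℝ, 1 < γ ∧ ∃ K : ℝ, ∀ q ℓ : ℕ, IsPrimePow q →
    ∀ (N : ℕ) (A B C : Fin N → Finset (Fin ℓ → ZMod q)), IsSTPP A B C →
      (∑ i, (((A i).card * (B i).card : ℕ) : ℝ) ≤ K * ((q : ℝ) / γ) ^ ℓ) ∨
      (∑ i, (((B i).card * (C i).card : ℕ) : ℝ) ≤ K * ((q : ℝ) / γ) ^ ℓ) ∨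
      (∑ i, (((C i).card * (A i).card : ℕ) : ℝ) ≤ K * ((q : ℝ) / γ) ^ ℓ)

/-- Unfolding of `Pratt2024_cor210` (literally the statement of the route item
`PrimePowerPackingBarrier`; both are refuted by `not_Pratt2024_cor210`). [cite: Pratt2024, Cor. 2.10] -/
theorem pratt2024_cor210_iff :
    Pratt2024_cor210 ↔
      ∃ γ : ℝ, 1 < γ ∧ ∃ K : ℝ, ∀ q ℓ : ℕ, IsPrimePow q →
        ∀ (N : ℕ) (A B C : Fin N → Finset (Fin ℓ → ZMod q)), IsSTPP A B C →
          (∑ i, (((A i).card * (B i).card : ℕ) : ℝ) ≤ K * ((q : ℝ) / γ) ^ ℓ) ∨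
          (∑ i, (((B i).card * (C i).card : ℕ) : ℝ) ≤ K * ((q : ℝ) / γ) ^ ℓ) ∨
          (∑ i, (((C i).card * (A i).card : ℕ) : ℝ) ≤ K * ((q : ℝ) / γ) ^ ℓ) :=
  Iff.rfl

/-- **The printed form implies the vendored one**: Cor. 2.10 as printed (one absolute `C > 1`, bound
`(q/C)^ℓ`, i.e. `K = 1`) gives `Pratt2024_cor210` with `γ = C`, `K = 1` — so the printed form is
refuted together with `Pratt2024_cor210` (`not_Pratt2024_cor210`). [cite: Pratt2024, Cor. 2.10] -/
theorem Pratt2024_cor210.of_pow_le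
    (h : ∃ C : ℝ, 1 < C ∧ ∀ q ℓ : ℕ, IsPrimePow q →
      ∀ (N : ℕ) (A B C' : Fin N → Finset (Fin ℓ → ZMod q)), IsSTPP A B C' →
        (∑ i, (((A i).card * (B i).card : ℕ) : ℝ) ≤ ((q : ℝ) / C) ^ ℓ) ∨
        (∑ i, (((B i).card * (C' i).card : ℕ) : ℝ) ≤ ((q : ℝ) / C) ^ ℓ) ∨
        (∑ i, (((C' i).card * (A i).card : ℕ) : ℝ) ≤ ((q : ℝ) / C) ^ ℓ)) :
    Pratt2024_cor210 := by
  obtain ⟨C, hC, hmain⟩ := h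
  refine ⟨C, hC, 1, fun q ℓ hq N A B C' hS => ?_⟩
  simpa only [one_mul] using hmain q ℓ hq N A B C' hS

/-- **Monotonicity in the constants**: the barrier with constants `(γ, K)` implies it with any
`γ' ∈ (1, γ]` and `K' ≥ K` (for `K ≥ 0`), since `(q/γ)^ℓ ≤ (q/γ')^ℓ`. Useful to run the transfer
(Pratt, Thm. 4.4) with a convenient `γ'`. [cite: Pratt2024, Thm. 4.4 (proof)] -/
theorem Pratt2024_cor210.mono {γ γ' K K' : ℝ} (hγ' : 1 < γ') (hle : γ' ≤ γ) (hK : 0 ≤ K)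
    (hKK' : K ≤ K')
    (h : ∀ q ℓ : ℕ, IsPrimePow q →
      ∀ (N : ℕ) (A B C : Fin N → Finset (Fin ℓ → ZMod q)), IsSTPP A B C →
        (∑ i, (((A i).card * (B i).card : ℕ) : ℝ) ≤ K * ((q : ℝ) / γ) ^ ℓ) ∨
        (∑ i, (((B i).card * (C i).card : ℕ) : ℝ) ≤ K * ((q : ℝ) / γ) ^ ℓ) ∨
        (∑ i, (((C i).card * (A i).card : ℕ) : ℝ) ≤ K * ((q : ℝ) / γ) ^ ℓ)) :
    ∀ q ℓ : ℕ, IsPrimePow q →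
      ∀ (N : ℕ) (A B C : Fin N → Finset (Fin ℓ → ZMod q)), IsSTPP A B C →
        (∑ i, (((A i).card * (B i).card : ℕ) : ℝ) ≤ K' * ((q : ℝ) / γ') ^ ℓ) ∨
        (∑ i, (((B i).card * (C i).card : ℕ) : ℝ) ≤ K' * ((q : ℝ) / γ') ^ ℓ) ∨
        (∑ i, (((C i).card * (A i).card : ℕ) : ℝ) ≤ K' * ((q : ℝ) / γ') ^ ℓ) := by
  intro q ℓ hq N A B C hS
  have hq0 : (0 : ℝ) ≤ q := Nat.cast_nonneg q
  have hγ0 : 0 < γ' := zero_lt_one.trans hγ'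
  have hpow : ((q : ℝ) / γ) ^ ℓ ≤ ((q : ℝ) / γ') ^ ℓ :=
    pow_le_pow_left₀ (div_nonneg hq0 (hγ0.le.trans hle)) (div_le_div_of_nonneg_left hq0 hγ0 hle) ℓ
  have hstep : K * ((q : ℝ) / γ) ^ ℓ ≤ K' * ((q : ℝ) / γ') ^ ℓ :=
    (mul_le_mul_of_nonneg_left hpow hK).trans
      (mul_le_mul_of_nonneg_right hKK' (pow_nonneg (div_nonneg hq0 hγ0.le) ℓ))
  rcases h q ℓ hq N A B C hS with h1 | h2 | h3
  · exact Or.inl (h1.trans hstep)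
  · exact Or.inr (Or.inl (h2.trans hstep))
  · exact Or.inr (Or.inr (h3.trans hstep))

end Packing

end Literature.Combinatorics.Additive

end
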